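import Summits.HodgeConjecture.HodgeConjecture.Cruxes.BlochSeedDiscOne.DepthBoundA4

/-!
line stmt-HodgeConjecture-18881 Cruxes/BlochSeedDiscOne/Lines/birth.lean 814a6a70c14e831a stub_rung_pad4_seedAt

# PatternedPorteous — LAW PP, the exact letter-level local-freeness test for two-term displays with a prescribed arrow pattern
(typed companion of `PATTERNED-PORTEOUS-monad3-g16.md`, hsemireg-monad-3 g16, 2026-08-30; stdlib engine `g16/code/pp.py`).  Imports `DepthBoundA4` only.

STATUS ∕ SCOPE.  Letter-model bookkeeping on `DepthBoundA4.Design` only.  A letter design ≠ a display ≠ a sheaf ≠ a SEED; NOTHING here is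
proved toward HC ∕ HC_CM ∕ HC_AV ∕ №4 ∕ 26512 ∕ 18881 ∕ H2; STUB R (`stub_rung_pad4_seedAt`) untouched; `Nonex 14 199 8` stays REFUTED as typed
(`RotatedPairB136`).  What is DEFINED here (computably, instance-free, `Bool` inside ∕ `Prop` outside):
* §1 the letter ring `⊗_{f<4} ℤ{1, h_f, d_f, g_f, pt_f}` (`h² = 2pt`, `d² = g² = −2pt`, `hd = hg = dg = 0`; a letter `(a;x,y)` on factor `f`
  is `a·h_f + x·d_f − y·g_f`, so `ℓ·ℓ' = 2(aa' − xx' − yy')·pt_f`) as SORTED SPARSE association lists over the 625 monomial codes, with the total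
  Chern class of a cell sum `c(⊕ L_y^{m_y} − ⊕ L_x^{m_x}) = ∏(1+[y])^{m_y} ∏(1+[x])^{−m_x}` (`chernVirtual`; exact, degrees ≤ 8 automatically);
* §2 the three arrow relations of the memos as `Bool` tests with bridges to `DepthBoundA4`: `effB` (EFFECTIVE: each factor EQUAL or four-AMPLE —
  the director's «EffArrow», R19.619), `liveB` (four-ample on every factor = `DepthBoundA4.Live`), `weakB` (= `DepthBoundA4.WeakLive`: no DEAD factor);
* §3 LAW PP's decidable objects for an arrow test `arr`: receivers `Γ(x)`, the CLOSED receiver sets `R` (unions of neighbourhoods), the FULL sender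
  set `T_R = {x ∈ P : Γ(x) ⊆ R}` (cells with no arrow included), the surplus `S_R = m_N(R) − m_P(T_R)`, the digit test «every monomial of
  `c(N[R] − P[T_R])` has degree ≤ S_R» for `0 ≤ S_R ≤ 7`, and the predicates `PPClean arr D` («no closed R with T_R ≠ ∅ has S_R < 0, and none with
  0 ≤ S_R ≤ 7 has a Chern monomial of degree > S_R») and `PortHall arr D k` («every closed R with T_R ≠ ∅ has S_R ≥ k»; `PortHall effB D 8` is the
  bus's PortHall₈(EffArrow), = HallPlus(8) by max-flow ∕ min-cut, pen);  `portHall_eight_ppClean : PortHall arr D 8 → PPClean arr D` (trivial);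
* §4 kernel values (`decide +kernel`) on the memo's toy LEGGED designs and on the bus designs PS7 (l.12179) and CHIRAL(7;4,3)+8∕12·hub⁴ (l.12241):
  `PPClean` holds at Hall margins 1, 2, 3, 4 (so `¬ PortHall · · 8`) on LEG3-m1n3, LEG3-m2n5, LEG2-m1n5, LEG2-m2n6, MIX-A, NUL4-m1n2, and fails on
  LEG3-m1n2, LEG2-m1n4, LEG2-m2n5, MIX-B, NUL4-m1n1, on PS7 (Hall margin 4, `c₅ ≠ 0`) and on CHIRAL-hub8; it holds with `PortHall 8` on CHIRAL-hub12.

WHAT IS *NOT* FORMALISED (pen, cited in the memo §1): the GEOMETRIC content of LAW PP — (i) NECESSITY for ANY maps and ANY ties, with NO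
positivity hypothesis: if some `φ : ⊕_P L_x^{m_x} → ⊕_N L_y^{m_y}` with `Hom`-pattern inside `arr` is injective at every point of `X = (E_i × E_i)⁴`
then `PPClean arr D` (Fulton, Intersection Theory, Thm 14.4(a) p. 246 — the Porteous class is supported on the degeneracy locus — in the Whitney
form `c(N[R]) = c(P[T_R])·c(coker σ_R)`, `σ_R` = the closed sub-display, locally free of rank `S_R`); (ii) SUFFICIENCY for GENERIC maps when every
used arrow block is globally generated (Fulton Ex. 14.3.2(d) p. 244 + the patterned incidence count, Ex. 12.1.11 p. 212; positivity of the
top class of a g.g. bundle, Ex. 14.4.13 ∕ Thm 14.4(b)); Lemma C (closed receiver sets suffice).  The `Bool` tests below only EVALUATE the law.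

No `sorry`, no `axiom`, no `instance`, no notation, no `native_decide`, no unsafe options.  Words by director-hodge only.
-/

set_option linter.dupNamespace false
set_option autoImplicit false
set_option maxRecDepth 16384
set_option maxHeartbeats 8000000

namespace Summit.HodgeConjecture.HodgeConjecture.Cruxes.BlochSeedDiscOne.PatternedPorteous

open Summit.HodgeConjecture.HodgeConjecture.Cruxes.BlochSeedDiscOne.DepthBoundA4

/-! ## §0 Boolean helpers (the `LFLadderB136.lean` §1 idiom, re-declared so that this file imports `DepthBoundA4` only) -/

/-- every element passes (tail form). -/
def allB {α : Type} : List α → (α → Bool) → Bool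
  | [], _ => true
  | x :: l, f => match f x with | true => allB l f | false => false

theorem allB_iff {α : Type} (l : List α) (f : α → Bool) : allB l f = true ↔ ∀ x ∈ l, f x = true := by
  induction l with
  | nil => simp [allB]
  | cons x l ih =>
    simp only [allB, List.mem_cons, forall_eq_or_imp]
    cases hx : f x <;> simp [ih]

/-- some element passes (tail form). -/
def anyB {α : Type} : List α → (α → Bool) → Bool
  | [], _ => false
  | x :: l, f => match f x with | true => true | false => anyB l f

theorem anyB_iff {α : Type} (l : List α) (f : α → Bool) : anyB l f = true ↔ ∃ x ∈ l, f x = true := by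
  induction l with
  | nil => simp [anyB]
  | cons x l ih =>
    simp only [anyB, List.mem_cons, exists_eq_or_imp]
    cases hx : f x <;> simp [ih]

/-- a cell from four letters. -/
def cellOf (l₀ l₁ l₂ l₃ : Letter) : Cell := fun f =>
  match f with
  | ⟨0, _⟩ => l₀
  | ⟨1, _⟩ => l₁
  | ⟨2, _⟩ => l₂
  | ⟨_, _⟩ => l₃

/-- raw four-ample test on one factor (squares as products). -/
def ampleB (ℓ ℓ' : Letter) : Bool :=
  decide (ℓ.a < ℓ'.a) && decide ((ℓ'.x - ℓ.x) * (ℓ'.x - ℓ.x) + (ℓ'.y - ℓ.y) * (ℓ'.y - ℓ.y) < (ℓ'.a - ℓ.a) * (ℓ'.a - ℓ.a))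

theorem ampleB_iff (ℓ ℓ' : Letter) : ampleB ℓ ℓ' = true ↔ AmpleAbove ℓ ℓ' := by
  simp only [ampleB, AmpleAbove, Bool.and_eq_true, decide_eq_true_eq, pow_two]

/-- LIVE (four-ample on every factor). -/
def liveB (x y : Cell) : Bool := ampleB (x 0) (y 0) && ampleB (x 1) (y 1) && ampleB (x 2) (y 2) && ampleB (x 3) (y 3)

theorem liveB_iff (x y : Cell) : liveB x y = true ↔ Live x y := by
  simp only [liveB, Bool.and_eq_true, ampleB_iff, Live]
  constructor
  · rintro ⟨⟨⟨h0, h1⟩, h2⟩, h3⟩ f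
    fin_cases f
    · exact h0
    · exact h1
    · exact h2
    · exact h3
  · intro h
    exact ⟨⟨⟨h 0, h 1⟩, h 2⟩, h 3⟩

/-- raw cell equality. -/
def cellEqB (x y : Cell) : Bool := decide (x 0 = y 0) && decide (x 1 = y 1) && decide (x 2 = y 2) && decide (x 3 = y 3)

theorem cellEqB_iff (x y : Cell) : cellEqB x y = true ↔ x = y := by
  constructor
  · intro h
    simp only [cellEqB, Bool.and_eq_true, decide_eq_true_eq] at h
    obtain ⟨⟨⟨h0, h1⟩, h2⟩, h3⟩ := h
    funext f
    fin_cases f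
    · exact h0
    · exact h1
    · exact h2
    · exact h3
  · rintro rfl
    simp [cellEqB]

/-- raw list membership of a cell. -/
def memB (T : List Cell) (x : Cell) : Bool := anyB T fun y => cellEqB x y

theorem memB_iff (T : List Cell) (x : Cell) : memB T x = true ↔ x ∈ T := by
  unfold memB
  rw [anyB_iff]
  constructor
  · rintro ⟨y, hy, he⟩
    rw [cellEqB_iff] at he
    exact he ▸ hy
  · intro hx
    exact ⟨x, hx, (cellEqB_iff x x).2 rfl⟩

/-! ## §1 The letter ring as sorted sparse lists over monomial codes

A monomial is coded `m = d₀ + 5·d₁ + 25·d₂ + 125·d₃` with `d_f ∈ {0,1,2,3,4} = {1, h_f, d_f, g_f, pt_f}`; its degree is `Σ_f deg d_f` with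
`deg 0 = 0`, `deg 4 = 2`, else `1`.  An element is a list of `(code, coefficient)` pairs, kept SORTED by code with non-zero coefficients by every
operation below (multiplication by a basis letter term is monotone on codes — it raises one digit `0 ↦ i ↦ 4` — and sums are sorted merges). -/

/-- an element of the letter ring: sorted sparse list `(monomial code, coefficient)`. -/
abbrev LR := List (ℕ × ℤ)

/-- digit `f` of a monomial code. -/
def digit (m f : ℕ) : ℕ := (m / 5 ^ f) % 5

/-- degree of one digit. -/
def ddeg (d : ℕ) : ℕ := if d = 0 then 0 else if d = 4 then 2 else 1

/-- degree of a monomial code. -/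
def mdeg (m : ℕ) : ℕ := ddeg (digit m 0) + ddeg (digit m 1) + ddeg (digit m 2) + ddeg (digit m 3)

/-- product of the monomial `m` with the basis letter `i ∈ {1,2,3} = {h,d,g}` on factor `f`: `none` if zero, else the new code and the scalar
(`h·h = 2pt`, `d·d = g·g = −2pt`, mixed products and `pt·(anything of positive degree)` vanish). -/
def mulMono (m f i : ℕ) : Option (ℕ × ℤ) :=
  if digit m f = 0 then some (m + i * 5 ^ f, 1)
  else if digit m f = i then some (m + (4 - i) * 5 ^ f, if i = 1 then 2 else -2)
  else none

/-- multiply an element by the basis term `c · (letter i on factor f)`; sortedness is preserved. -/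
def mulTerm (A : LR) (f i : ℕ) (c : ℤ) : LR :=
  A.filterMap fun t =>
    match mulMono t.1 f i with
    | none => none
    | some ms => if ms.2 * c * t.2 = 0 then none else some (ms.1, ms.2 * c * t.2)

/-- sorted merge with addition of coefficients (fuelled structural recursion). -/
def mergeAddF : ℕ → LR → LR → LR
  | 0, A, B => A ++ B
  | _ + 1, [], B => B
  | _ + 1, A, [] => A
  | n + 1, a :: A, b :: B =>
    if a.1 < b.1 then a :: mergeAddF n A (b :: B)
    else if b.1 < a.1 then b :: mergeAddF n (a :: A) B
    else if a.2 + b.2 = 0 then mergeAddF n A B else (a.1, a.2 + b.2) :: mergeAddF n A B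

/-- sum of two elements. -/
def mergeAdd (A B : LR) : LR := mergeAddF (A.length + B.length + 1) A B

/-- negation. -/
def negLR (A : LR) : LR := A.map fun t => (t.1, -t.2)

/-- a degree-one element = list of basis terms `(factor, letter index, coefficient)`. -/
abbrev Lin := List (ℕ × ℕ × ℤ)

/-- product of an element with a degree-one element. -/
def mulLin (A : LR) (X : Lin) : LR := X.foldl (fun acc t => mergeAdd acc (mulTerm A t.1 t.2.1 t.2.2)) []

/-- the class of a cell: `Σ_f (a_f·h_f + x_f·d_f − y_f·g_f)` as basis terms (zero coefficients dropped). -/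
def cellLin (c : Cell) : Lin :=
  (([(0 : ℕ), 1, 2, 3].map fun f =>
      let ℓ := c (Fin.ofNat 4 f)
      [(f, (1 : ℕ), ℓ.a), (f, 2, ℓ.x), (f, 3, -ℓ.y)]).flatten).filter fun t => decide (t.2.2 ≠ 0)

/-- `A · (1 + X)`. -/
def timesOnePlus (A : LR) (X : Lin) : LR := mergeAdd A (mulLin A X)

/-- `A · (1 + X)^m`. -/
def timesPow : ℕ → LR → Lin → LR
  | 0, A, _ => A
  | m + 1, A, X => timesPow m (timesOnePlus A X) X

/-- `A · (1 + X)^{−1} = Σ_{k ≤ 8} (−1)^k A X^k` (exact: `X⁹ = 0`). -/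
def divGo : ℕ → LR → LR → Lin → LR
  | 0, _, acc, _ => acc
  | n + 1, T, acc, X => let T' := negLR (mulLin T X); divGo n T' (mergeAdd acc T') X

/-- `A · (1 + X)^{−1}`. -/
def divOnePlus (A : LR) (X : Lin) : LR := divGo 8 A A X

/-- `A · (1 + X)^{−m}`. -/
def divPow : ℕ → LR → Lin → LR
  | 0, A, _ => A
  | m + 1, A, X => divPow m (divOnePlus A X) X

/-- the unit. -/
def oneLR : LR := [(0, 1)]

/-- total Chern class of the virtual bundle `⊕_{(y,m) ∈ N} L_y^m − ⊕_{(x,m) ∈ P} L_x^m`. -/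
def chernVirtual (N P : List (Cell × ℕ)) : LR :=
  P.foldl (fun acc cm => divPow cm.2 acc (cellLin cm.1)) (N.foldl (fun acc cm => timesPow cm.2 acc (cellLin cm.1)) oneLR)

/-- every monomial present has degree `≤ S`. -/
def cleanAbove (C : LR) (S : ℕ) : Bool := allB C fun t => decide (mdeg t.1 ≤ S)

/-- the monomials of degree `j` (the digit `c_j`, as a sorted sparse list). -/
def degPart (C : LR) (j : ℕ) : LR := C.filter fun t => decide (mdeg t.1 = j)

/-! ## §2 Arrow relations (`Bool`, with bridges) -/

/-- EFFECTIVE step on one factor: equal or four-ample. -/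
def effStepB (ℓ ℓ' : Letter) : Bool := decide (ℓ = ℓ') || ampleB ℓ ℓ'

/-- EFFECTIVE arrow (the director's `EffArrow`): every factor equal or four-ample. -/
def EffArrow (x y : Cell) : Prop := ∀ f : Fin 4, x f = y f ∨ AmpleAbove (x f) (y f)

/-- its `Bool` test. -/
def effB (x y : Cell) : Bool := effStepB (x 0) (y 0) && effStepB (x 1) (y 1) && effStepB (x 2) (y 2) && effStepB (x 3) (y 3)

theorem effStepB_iff (ℓ ℓ' : Letter) : effStepB ℓ ℓ' = true ↔ (ℓ = ℓ' ∨ AmpleAbove ℓ ℓ') := by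
  simp only [effStepB, Bool.or_eq_true, decide_eq_true_eq, ampleB_iff]

theorem effB_iff (x y : Cell) : effB x y = true ↔ EffArrow x y := by
  simp only [effB, Bool.and_eq_true, effStepB_iff, EffArrow]
  constructor
  · rintro ⟨⟨⟨h0, h1⟩, h2⟩, h3⟩ f
    fin_cases f
    · exact h0
    · exact h1
    · exact h2
    · exact h3
  · intro h
    exact ⟨⟨⟨h 0, h 1⟩, h 2⟩, h 3⟩

/-- NOT-DEAD step on one factor (equal, or null∕ample above). -/
def notDeadB (ℓ ℓ' : Letter) : Bool :=
  decide (ℓ = ℓ') || (decide (ℓ.a < ℓ'.a) && decide ((ℓ'.x - ℓ.x) * (ℓ'.x - ℓ.x) + (ℓ'.y - ℓ.y) * (ℓ'.y - ℓ.y) ≤ (ℓ'.a - ℓ.a) * (ℓ'.a - ℓ.a)))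

theorem notDeadB_iff (ℓ ℓ' : Letter) : notDeadB ℓ ℓ' = true ↔ NotDead ℓ ℓ' := by
  simp only [notDeadB, NotDead, Bool.or_eq_true, Bool.and_eq_true, decide_eq_true_eq, pow_two]

/-- WEAK arrow = `DepthBoundA4.WeakLive` (no dead factor). -/
def weakB (x y : Cell) : Bool := notDeadB (x 0) (y 0) && notDeadB (x 1) (y 1) && notDeadB (x 2) (y 2) && notDeadB (x 3) (y 3)

theorem weakB_iff (x y : Cell) : weakB x y = true ↔ WeakLive x y := by
  simp only [weakB, Bool.and_eq_true, notDeadB_iff, WeakLive]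
  constructor
  · rintro ⟨⟨⟨h0, h1⟩, h2⟩, h3⟩ f
    fin_cases f
    · exact h0
    · exact h1
    · exact h2
    · exact h3
  · intro h
    exact ⟨⟨⟨h 0, h 1⟩, h 2⟩, h 3⟩

theorem effB_liveB {x y : Cell} (h : liveB x y = true) : effB x y = true := by
  rw [liveB_iff] at h
  rw [effB_iff]
  exact fun f => Or.inr (h f)

theorem weakB_effB {x y : Cell} (h : effB x y = true) : weakB x y = true := by
  rw [effB_iff] at h
  rw [weakB_iff]
  intro f
  rcases h f with he | ha
  · exact Or.inl he
  · exact Or.inr ⟨ha.1, le_of_lt ha.2⟩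

/-! ## §3 LAW PP's decidable objects -/

/-- receivers of `x`: the N-cells `y` of the support with `arr x y`. -/
def nbhd (arr : Cell → Cell → Bool) (D : Design) (x : Cell) : List Cell := D.suppN.filter fun y => arr x y

/-- union of two receiver sets, as the canonical sub-list of `suppN`. -/
def unionIn (D : Design) (A B : List Cell) : List Cell := D.suppN.filter fun y => memB A y || memB B y

/-- element-wise equality of cell lists. -/
def listEqB : List Cell → List Cell → Bool
  | [], [] => true
  | x :: A, y :: B => cellEqB x y && listEqB A B
  | _, _ => false

/-- one closure step: add the unions of every set found so far with `g`. -/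
def closeStep (D : Design) (acc : List (List Cell)) (g : List Cell) : List (List Cell) :=
  (acc.map fun R => unionIn D R g).foldl (fun a R => if anyB a (fun R' => listEqB R R') then a else a ++ [R]) acc

/-- the CLOSED receiver sets: all unions of neighbourhoods `Γ(x)`, `x ∈ suppP` (the empty union included). -/
def closedSets (arr : Cell → Cell → Bool) (D : Design) : List (List Cell) :=
  (D.suppP.map fun x => nbhd arr D x).foldl (closeStep D) [[]]

/-- the FULL sender set of `R`: the P-entries all of whose receivers lie in `R` (entries with no receiver at all included). -/
def TR (arr : Cell → Cell → Bool) (D : Design) (R : List Cell) : List (Cell × ℕ) :=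
  D.P.filter fun xm => decide (0 < xm.2) && allB (nbhd arr D xm.1) (fun y => memB R y)

/-- the N-entries with cell in `R`. -/
def NR (D : Design) (R : List Cell) : List (Cell × ℕ) := D.N.filter fun ym => decide (0 < ym.2) && memB R ym.1

/-- `m_N(R)`. -/
def massNR (D : Design) (R : List Cell) : ℕ := ((NR D R).map Prod.snd).sum

/-- `m_P(T_R)`. -/
def massTR (arr : Cell → Cell → Bool) (D : Design) (R : List Cell) : ℕ := ((TR arr D R).map Prod.snd).sum

/-- LAW PP's test of ONE closed set: `T_R = ∅`, or (`S_R ≥ 0` and (`S_R ≥ 8` or every Chern monomial of `c(N[R] − P[T_R])` has degree `≤ S_R`)). -/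
def ppItemB (arr : Cell → Cell → Bool) (D : Design) (R : List Cell) : Bool :=
  (TR arr D R).isEmpty ||
    (decide (massTR arr D R ≤ massNR D R) &&
      (decide (massTR arr D R + 8 ≤ massNR D R) || cleanAbove (chernVirtual (NR D R) (TR arr D R)) (massNR D R - massTR arr D R)))

/-- LAW PP's test of a design. -/
def ppCleanB (arr : Cell → Cell → Bool) (D : Design) : Bool := allB (closedSets arr D) (ppItemB arr D)

/-- `PPClean arr D`: the design passes LAW PP for the arrow relation `arr` (NECESSARY for local freeness of ANY display with that pattern, pen (i);
SUFFICIENT for a generic display when all used blocks are globally generated, pen (ii)). -/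
def PPClean (arr : Cell → Cell → Bool) (D : Design) : Prop := ppCleanB arr D = true

/-- the surplus-`k` Hall test on closed sets (`k = 8`: PortHall₈ ∕ HallPlus(8); `k = 0`: Hall). -/
def portHallB (arr : Cell → Cell → Bool) (D : Design) (k : ℕ) : Bool :=
  allB (closedSets arr D) fun R => (TR arr D R).isEmpty || decide (massTR arr D R + k ≤ massNR D R)

/-- `PortHall arr D k`: every closed receiver set with a sender has surplus `≥ k`. -/
def PortHall (arr : Cell → Cell → Bool) (D : Design) (k : ℕ) : Prop := portHallB arr D k = true

/-- the Hall margin: `min S_R` over closed `R` with `T_R ≠ ∅` (`none` if no P-cell). -/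
def hallMargin (arr : Cell → Cell → Bool) (D : Design) : Option ℤ :=
  ((closedSets arr D).filter fun R => !(TR arr D R).isEmpty).foldl
    (fun o R => let s : ℤ := (massNR D R : ℤ) - (massTR arr D R : ℤ); match o with | none => some s | some s' => some (min s s')) none

theorem portHall_eight_ppClean (arr : Cell → Cell → Bool) (D : Design) (h : PortHall arr D 8) : PPClean arr D := by
  unfold PortHall portHallB at h
  unfold PPClean ppCleanB
  rw [allB_iff] at h ⊢
  intro R hR
  have hR' := h R hR
  unfold ppItemB
  rcases Bool.or_eq_true_iff.1 hR' with he | hk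
  · rw [he]; rfl
  · simp only [Bool.or_eq_true, Bool.and_eq_true, decide_eq_true_eq] at hk ⊢
    exact Or.inr ⟨by omega, Or.inl hk⟩

theorem portHall_mono (arr : Cell → Cell → Bool) (D : Design) {k k' : ℕ} (hk : k' ≤ k) (h : PortHall arr D k) : PortHall arr D k' := by
  unfold PortHall portHallB at h ⊢
  rw [allB_iff] at h ⊢
  intro R hR
  have := h R hR
  simp only [Bool.or_eq_true, decide_eq_true_eq] at this ⊢
  rcases this with he | hle
  · exact Or.inl he
  · exact Or.inr (by omega)

/-! ## §4 Kernel values -/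

/-- the common leg letter `(3;2,2)` (height 7). -/
def lL : Letter := ⟨3, 2, 2⟩
/-- hub letter of height 7. -/
def l7 : Letter := ⟨7, 0, 0⟩
/-- the moving P-letter `(4;1,2)` (step to `l7` is `(3;−1,−2)`, type (1,4), globally generated). -/
def lP : Letter := ⟨4, 1, 2⟩
/-- null leg of content 4: `(3;0,4) → (7;0,0)`. -/
def lN4 : Letter := ⟨3, 0, 4⟩
/-- null leg of content 1: `(6;0,1) → (7;0,0)` (a WALL: h⁰ = 1). -/
def lN1 : Letter := ⟨6, 0, 1⟩

/-- `hub⁴` at height 7. -/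
def hub7 : Cell := cellOf l7 l7 l7 l7
/-- three equal legs, moving factor 3. -/
def x3 : Cell := cellOf lL lL lL lP
/-- its receiver. -/
def y3 : Cell := cellOf lL lL lL l7
/-- two equal legs, moving factors 2, 3. -/
def x2 : Cell := cellOf lL lL lP lP
/-- its receiver. -/
def y2 : Cell := cellOf lL lL l7 l7
/-- null content-4 leg. -/
def xn4 : Cell := cellOf lL lL lL lN4
/-- null content-1 leg. -/
def xn1 : Cell := cellOf lL lL lL lN1

/-- LEG3-m1n2. -/ def LEG3m1n2 : Design := ⟨[(y3, 2)], [(x3, 1)]⟩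
/-- LEG3-m1n3. -/ def LEG3m1n3 : Design := ⟨[(y3, 3)], [(x3, 1)]⟩
/-- LEG3-m2n5. -/ def LEG3m2n5 : Design := ⟨[(y3, 5)], [(x3, 2)]⟩
/-- LEG2-m1n4. -/ def LEG2m1n4 : Design := ⟨[(y2, 4)], [(x2, 1)]⟩
/-- LEG2-m1n5. -/ def LEG2m1n5 : Design := ⟨[(y2, 5)], [(x2, 1)]⟩
/-- LEG2-m2n5. -/ def LEG2m2n5 : Design := ⟨[(y2, 5)], [(x2, 2)]⟩
/-- LEG2-m2n6. -/ def LEG2m2n6 : Design := ⟨[(y2, 6)], [(x2, 2)]⟩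
/-- MIX-A. -/ def MIXA : Design := ⟨[(y3, 3), (hub7, 2)], [(x3, 1)]⟩
/-- MIX-B. -/ def MIXB : Design := ⟨[(y3, 2), (hub7, 1)], [(x3, 1)]⟩
/-- NUL4-m1n1. -/ def NUL4m1n1 : Design := ⟨[(y3, 1)], [(xn4, 1)]⟩
/-- NUL4-m1n2. -/ def NUL4m1n2 : Design := ⟨[(y3, 2)], [(xn4, 1)]⟩
/-- NUL1-m1n2. -/ def NUL1m1n2 : Design := ⟨[(y3, 2)], [(xn1, 1)]⟩

/-- the k-th rotation `ρᵏ` of a letter (`ρ(a;x,y) = (a;−y,x)`), diagonal cell. -/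
def diag (ℓ : Letter) (k : ℕ) : Cell := let r := Letter.rotPow k ℓ; cellOf r r r r

/-- PS7 (gs-eng-2 g62, bus l.12179; h = 7 phase-swap design): `N = 8·hub⁴ + Σ_{k<4} (ρᵏ(4;2,1))⁴`, `P = Σ_{k<4} (ρᵏ(4;1,2))⁴`. -/
def PS7 : Design :=
  ⟨(hub7, 8) :: ([0, 1, 2, 3].map fun k => (diag ⟨4, 2, 1⟩ k, 1)), [0, 1, 2, 3].map fun k => (diag ⟨4, 1, 2⟩ k, 1)⟩

/-- `hub⁴` at height 14. -/
def hub14 : Cell := cellOf ⟨14, 0, 0⟩ ⟨14, 0, 0⟩ ⟨14, 0, 0⟩ ⟨14, 0, 0⟩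
/-- s4-search-1 g35's CHIRAL(7;4,3) + j·hub⁴ (bus l.12241; files `chiral/CHIRAL-743-hub8∕12.json`): `N = j·hub⁴ + Σ_k (ρᵏ(7;4,−3))⁴`,
`P = Σ_k (ρᵏ(7;4,3))⁴`. -/
def CHIRAL (j : ℕ) : Design :=
  ⟨(hub14, j) :: ([0, 1, 2, 3].map fun k => (diag ⟨7, 4, -3⟩ k, 1)), [0, 1, 2, 3].map fun k => (diag ⟨7, 4, 3⟩ k, 1)⟩

/-! ### values -/

theorem leg3_m1n2 : ppCleanB effB LEG3m1n2 = false ∧ hallMargin effB LEG3m1n2 = some 1 := by decide +kernel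
theorem leg3_m1n3 : ppCleanB effB LEG3m1n3 = true ∧ hallMargin effB LEG3m1n3 = some 2 ∧ portHallB effB LEG3m1n3 8 = false := by decide +kernel
theorem leg3_m2n5 : ppCleanB effB LEG3m2n5 = true ∧ hallMargin effB LEG3m2n5 = some 3 ∧ portHallB effB LEG3m2n5 8 = false := by decide +kernel
theorem leg2_m1n4 : ppCleanB effB LEG2m1n4 = false ∧ hallMargin effB LEG2m1n4 = some 3 := by decide +kernel
theorem leg2_m1n5 : ppCleanB effB LEG2m1n5 = true ∧ hallMargin effB LEG2m1n5 = some 4 ∧ portHallB effB LEG2m1n5 8 = false := by decide +kernel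
theorem leg2_m2n5 : ppCleanB effB LEG2m2n5 = false ∧ hallMargin effB LEG2m2n5 = some 3 := by decide +kernel
theorem leg2_m2n6 : ppCleanB effB LEG2m2n6 = true ∧ hallMargin effB LEG2m2n6 = some 4 ∧ portHallB effB LEG2m2n6 8 = false := by decide +kernel
theorem mixA : ppCleanB effB MIXA = true ∧ hallMargin effB MIXA = some 4 ∧ portHallB effB MIXA 8 = false := by decide +kernel
theorem mixB : ppCleanB effB MIXB = false ∧ hallMargin effB MIXB = some 2 := by decide +kernel
theorem nul4_m1n1 : ppCleanB weakB NUL4m1n1 = false ∧ hallMargin weakB NUL4m1n1 = some 0 := by decide +kernel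
theorem nul4_m1n2 : ppCleanB weakB NUL4m1n2 = true ∧ hallMargin weakB NUL4m1n2 = some 1 := by decide +kernel
theorem nul1_m1n2 : ppCleanB weakB NUL1m1n2 = true ∧ hallMargin weakB NUL1m1n2 = some 1 := by decide +kernel

/-- the digit that kills LEG3-m1n2: `c₂(2y − x) = 8·pt₃` (code `4·125 = 500`). -/
theorem leg3_m1n2_digit : degPart (chernVirtual [(y3, 2)] [(x3, 1)]) 2 = [(500, 8)] := by decide +kernel
/-- the digit that kills LEG2-m1n4: `c₄(4y − x) = 384·pt₂pt₃` (code `4·25 + 4·125 = 600`). -/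
theorem leg2_m1n4_digit : degPart (chernVirtual [(y2, 4)] [(x2, 1)]) 4 = [(600, 384)] := by decide +kernel

/-- `Prop` readings of three of the lines above. -/
theorem ppClean_leg3_m1n3 : PPClean effB LEG3m1n3 ∧ ¬ PortHall effB LEG3m1n3 8 := by
  refine ⟨leg3_m1n3.1, ?_⟩
  unfold PortHall
  rw [leg3_m1n3.2.2]
  exact Bool.false_ne_true

theorem ppClean_nul4_m1n2 : PPClean weakB NUL4m1n2 := nul4_m1n2.1

theorem not_ppClean_leg2_m1n4 : ¬ PPClean effB LEG2m1n4 := by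
  unfold PPClean
  rw [leg2_m1n4.1]
  exact Bool.false_ne_true


/-- PS7: Hall-clean (margin 4 on effective arrows = four-ample arrows here) but PP-dead: `c₅(8·hub − Σ_k x_k) ≠ 0` (40 monomials). -/
theorem ps7 : ppCleanB effB PS7 = false ∧ hallMargin effB PS7 = some 4 ∧ portHallB effB PS7 0 = true ∧
    (degPart (chernVirtual [(hub7, 8)] PS7.P) 5).length = 40 := by decide +kernel

/-- CHIRAL + 8·hub⁴: PP-dead at margin 4; CHIRAL + 12·hub⁴: `PortHall 8` and PP-clean (its blocks are four-ample of type (1,24), g.g.). -/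
theorem chiral_8 : ppCleanB effB (CHIRAL 8) = false ∧ hallMargin effB (CHIRAL 8) = some 4 := by decide +kernel
theorem chiral_12 : ppCleanB effB (CHIRAL 12) = true ∧ hallMargin effB (CHIRAL 12) = some 8 ∧ portHallB effB (CHIRAL 12) 8 = true := by
  decide +kernel

theorem ps7_readings : ¬ PPClean effB PS7 ∧ PortHall effB PS7 0 := by
  refine ⟨?_, ps7.2.2.1⟩
  unfold PPClean
  rw [ps7.1]
  exact Bool.false_ne_true

theorem chiral_12_readings : PPClean effB (CHIRAL 12) ∧ PortHall effB (CHIRAL 12) 8 := ⟨chiral_12.1, chiral_12.2.2⟩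

end Summit.HodgeConjecture.HodgeConjecture.Cruxes.BlochSeedDiscOne.PatternedPorteous
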